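import Mathlib
import HarnessLib
import Summits.Ventures.LatticeQCDFlow.Scaling.BoxRankedMorseBound

/-!
# LatticeQCDFlow / Scaling — FREE BOUNDARY, the count: in a box of side `R` of `(ℤ/L)^d` exactly
# `C(d,2)(R−1)²R^{d−2} − dR^{d−1}(R−1) + R^d − 1` plaquettes stay outside — `(R−1)³` in three dimensions
# (one per unit cube), `0` in two, `(R−1)³(3R+1)` in four

HONEST FRAMING: exact (Metropolis-corrected) sampling algorithms for lattice gauge theory;
figures of merit are autocorrelation/cost numbers at stated couplings and volumes; no
continuum-physics claim.

Venture `LatticeQCDFlow` (cell pub-lqcd), topic `Scaling`, FANOUT row 30 (lean-1, GEN-25) — OUR WORK on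
THEORY-2.md §4 row C5.  `BoxRankedMorseBound.isLeast_card_compl_ranked_box`: inside the box `K` (sites with
all coordinates below `R`, `R + 1 ≤ L`) the least number of box plaquettes outside a ranked one-plaquette
heat-bath structure `B ⊆ K` is `#(K ∖ Morse)`.  This file counts:

* §1 `card_filter_val_lt` / `card_filter_val_succ_lt` — `#{c ∈ ℤ/L : c.val < R} = R`,
  `#{c : c.val + 1 < R} = R − 1` (`R ≤ L`); **`two_mul_card_box`** — `2·#K = d(d−1)·(R−1)²·R^{d−2}`;
* §2 **`card_morse_inter_box_pair`** — for the axis pair `i < j` the Morse box plaquettes (prefix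
  `x_{<i} = 0`; the wrapped branch `x_i = −1` never meets the box) number `(R−1)²·R^{d−2−i}`;
  **`card_morse_inter_box`** — `#(Morse ∩ K) = Σ_i (d−1−i)(R−1)²R^{d−2−i}`, and the closed form
  **`card_morse_inter_box_closed`**: `#(Morse ∩ K) + R^d = d·R^{d−1}·(R−1) + 1`
  (`= #links(K) − #sites(K) + 1`: the box is contractible);
* §3 THE ANSWERS: **`isLeast_card_compl_ranked_box_three`** — in a three-dimensional box exactly `(R−1)³`
  plaquettes stay outside: ONE PER UNIT CUBE; **`isLeast_card_compl_ranked_box_two`** — NONE in two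
  dimensions; **`isLeast_card_compl_ranked_box_four`** — `(R−1)³(3R+1) = #cubes − #hypercubes` in four.
  The leading fraction `(d−2)/d` is the torus's: the dimension, not the periodicity, sets the price.

No `def`, no `sorry`, nothing cited as a fact beyond the tree.
-/

namespace Summit.Ventures.LatticeQCDFlow.Theory2.Autoregressive

open Finset
open Literature.MathematicalPhysics.QuantumFieldTheory

variable {d L R : ℕ} [NeZero L]

/-! ## §1 Counting residues below `R` and the box -/

/-- `#{c ∈ ℤ/L : c.val < R} = R` for `R ≤ L`. [folklore] -/
theorem card_filter_val_lt (hRL : R ≤ L) :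
    (Finset.univ.filter fun c : ZMod L => c.val < R).card = R := by
  classical
  have himg : (Finset.univ.filter fun c : ZMod L => c.val < R) =
      (Finset.range R).image (fun n : ℕ => (n : ZMod L)) := by
    ext c
    simp only [Finset.mem_filter, Finset.mem_univ, true_and, Finset.mem_image, Finset.mem_range]
    constructor
    · intro hc
      exact ⟨c.val, hc, ZMod.natCast_zmod_val c⟩
    · rintro ⟨n, hn, rfl⟩
      rw [ZMod.val_cast_of_lt (by omega)]; exact hn
  rw [himg, Finset.card_image_of_injOn, Finset.card_range]
  intro a ha b hb hab
  simp only [Finset.coe_range, Set.mem_Iio] at ha hb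
  have := congrArg ZMod.val hab
  rwa [ZMod.val_cast_of_lt (by omega), ZMod.val_cast_of_lt (by omega)] at this

/-- `#{c ∈ ℤ/L : c.val + 1 < R} = R − 1` for `R ≤ L`. [folklore] -/
theorem card_filter_val_succ_lt (hRL : R ≤ L) :
    (Finset.univ.filter fun c : ZMod L => c.val + 1 < R).card = R - 1 := by
  rw [← card_filter_val_lt (L := L) (R := R - 1) (by omega)]
  congr 1; ext c; simp only [Finset.mem_filter, Finset.mem_univ, true_and]; omega

omit [NeZero L] in
/-- A product over `Fin d` equal to `a` at the two indices `i ≠ j` and to `b` elsewhere is `a²·b^(d−2)`.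
[folklore] -/
theorem prod_ite_pair (i j : Fin d) (hij : i ≠ j) (a b : ℕ) :
    ∏ m : Fin d, (if m = i ∨ m = j then a else b) = a ^ 2 * b ^ (d - 2) := by
  classical
  rw [← Finset.prod_filter_mul_prod_filter_not Finset.univ (fun m : Fin d => m = i ∨ m = j)]
  have h1 : Finset.univ.filter (fun m : Fin d => m = i ∨ m = j) = {i, j} := by
    ext m; simp
  have h2 : ∏ m ∈ Finset.univ.filter (fun m : Fin d => m = i ∨ m = j),
      (if m = i ∨ m = j then a else b) = a ^ 2 := by
    rw [Finset.prod_congr rfl (fun m hm => if_pos (Finset.mem_filter.1 hm).2), Finset.prod_const, h1,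
      Finset.card_pair hij]
  have h3 : ∏ m ∈ Finset.univ.filter (fun m : Fin d => ¬ (m = i ∨ m = j)),
      (if m = i ∨ m = j then a else b) = b ^ (d - 2) := by
    rw [Finset.prod_congr rfl (fun m hm => if_neg (Finset.mem_filter.1 hm).2), Finset.prod_const]
    congr 1
    have := Finset.card_filter_add_card_filter_not (s := (Finset.univ : Finset (Fin d)))
      (fun m : Fin d => m = i ∨ m = j)
    rw [h1, Finset.card_pair hij, Finset.card_univ, Fintype.card_fin] at this
    omega
  rw [h2, h3]

/-- **`2·#K = d(d−1)·(R−1)²·R^{d−2}`**: the box has `C(d,2)·(R−1)²·R^{d−2}` plaquettes (`R ≤ L`). [ours] -/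
theorem two_mul_card_box (hRL : R ≤ L) (K : Finset (Plaquette d L))
    (hK : K = Finset.univ.filter (fun p : Plaquette d L =>
      (∀ m : Fin d, (p.1 m).val < R) ∧ (p.1 p.2.1.1).val + 1 < R ∧ (p.1 p.2.1.2).val + 1 < R)) :
    2 * K.card = d * (d - 1) * ((R - 1) ^ 2 * R ^ (d - 2)) := by
  classical
  subst hK
  rw [Finset.card_filter, Fintype.sum_prod_type_right]
  have hq : ∀ q : {q : Fin d × Fin d // q.1 < q.2},
      ∑ x : Site d L, (if (∀ m : Fin d, (x m).val < R) ∧ (x q.1.1).val + 1 < R ∧ (x q.1.2).val + 1 < R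
        then 1 else 0) = (R - 1) ^ 2 * R ^ (d - 2) := by
    intro q
    obtain ⟨⟨i, j⟩, hij⟩ := q
    simp only
    rw [← Finset.card_filter]
    have hset : (Finset.univ.filter fun x : Site d L =>
        (∀ m : Fin d, (x m).val < R) ∧ (x i).val + 1 < R ∧ (x j).val + 1 < R) =
        Fintype.piFinset (fun m : Fin d => if m = i ∨ m = j then
          (Finset.univ.filter fun c : ZMod L => c.val + 1 < R) else Finset.univ.filter fun c : ZMod L => c.val < R) := by
      ext x
      simp only [Finset.mem_filter, Finset.mem_univ, true_and, Fintype.mem_piFinset]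
      constructor
      · rintro ⟨hb, hi, hj⟩ m
        split_ifs with h
        · rcases h with rfl | rfl
          · exact Finset.mem_filter.2 ⟨Finset.mem_univ _, hi⟩
          · exact Finset.mem_filter.2 ⟨Finset.mem_univ _, hj⟩
        · exact Finset.mem_filter.2 ⟨Finset.mem_univ _, hb m⟩
      · intro h
        refine ⟨fun m => ?_, ?_, ?_⟩
        · have := h m
          split_ifs at this <;> have := (Finset.mem_filter.1 this).2 <;> omega
        · have := h i; rw [if_pos (Or.inl rfl)] at this; exact (Finset.mem_filter.1 this).2
        · have := h j; rw [if_pos (Or.inr rfl)] at this; exact (Finset.mem_filter.1 this).2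
    rw [hset, Fintype.card_piFinset]
    have hcard : ∀ m : Fin d, (if m = i ∨ m = j then (Finset.univ.filter fun c : ZMod L => c.val + 1 < R)
        else Finset.univ.filter fun c : ZMod L => c.val < R).card = if m = i ∨ m = j then R - 1 else R := by
      intro m
      split_ifs
      · exact card_filter_val_succ_lt hRL
      · exact card_filter_val_lt hRL
    simp_rw [hcard]
    exact prod_ite_pair i j (ne_of_lt hij) (R - 1) R
  simp_rw [hq]
  rw [Finset.sum_const, smul_eq_mul, Finset.card_univ, ← mul_assoc]
  congr 1
  rw [mul_comm, Fintype.card_subtype, card_filter_lt_mul_two]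

/-! ## §2 Counting the Morse structure cut to the box -/

/-- **For the axis pair `i < j` the Morse box plaquettes number `(R−1)²·R^{d−2−i}`** (`1 ≤ R ≤ L − 1`): the
prefix `x_{<i} = 0`, the two directions with room above, the rest free below `R`; the wrapped Morse branch
`x_i = −1` never meets the box. [ours] -/
theorem card_morse_inter_box_pair (hR : 1 ≤ R) (hRL : R + 1 ≤ L) {i j : Fin d} (hij : i < j) :
    (Finset.univ.filter fun x : Site d L =>
      ((∀ m : Fin d, m < i → x m = 0) ∧
        (x i ≠ -1 ∨ ((∀ m : Fin d, i < m → m < j → x m = 0) ∧ x j ≠ -1))) ∧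
      ((∀ m : Fin d, (x m).val < R) ∧ (x i).val + 1 < R ∧ (x j).val + 1 < R)).card =
      (R - 1) ^ 2 * R ^ (d - 2 - (i : ℕ)) := by
  classical
  haveI : Fact (1 < L) := ⟨by omega⟩
  have hneg1 : (-1 : ZMod L).val = L - 1 := by
    obtain ⟨n, hn⟩ := Nat.exists_eq_succ_of_ne_zero (NeZero.ne L)
    subst hn
    rw [ZMod.val_neg_one, Nat.succ_sub_one]
  have hne1 : ∀ c : ZMod L, c.val + 1 < R → c ≠ -1 := by
    intro c hc h; rw [h, hneg1] at hc; omega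
  have hset : (Finset.univ.filter fun x : Site d L =>
      ((∀ m : Fin d, m < i → x m = 0) ∧
        (x i ≠ -1 ∨ ((∀ m : Fin d, i < m → m < j → x m = 0) ∧ x j ≠ -1))) ∧
      ((∀ m : Fin d, (x m).val < R) ∧ (x i).val + 1 < R ∧ (x j).val + 1 < R)) =
      Fintype.piFinset (fun m : Fin d =>
        if m < i then ({0} : Finset (ZMod L))
        else if m = i ∨ m = j then Finset.univ.filter (fun c : ZMod L => c.val + 1 < R)
        else Finset.univ.filter (fun c : ZMod L => c.val < R)) := by
    ext x
    simp only [Finset.mem_filter, Finset.mem_univ, true_and, Fintype.mem_piFinset]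
    constructor
    · rintro ⟨⟨hpre, -⟩, hb, hi, hj⟩ m
      by_cases hm : m < i
      · rw [if_pos hm, Finset.mem_singleton]; exact hpre m hm
      · rw [if_neg hm]
        split_ifs with h
        · rcases h with rfl | rfl
          · exact Finset.mem_filter.2 ⟨Finset.mem_univ _, hi⟩
          · exact Finset.mem_filter.2 ⟨Finset.mem_univ _, hj⟩
        · exact Finset.mem_filter.2 ⟨Finset.mem_univ _, hb m⟩
    · intro h
      have hi : (x i).val + 1 < R := by
        have := h i; rw [if_neg (lt_irrefl _), if_pos (Or.inl rfl)] at this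
        exact (Finset.mem_filter.1 this).2
      have hj : (x j).val + 1 < R := by
        have := h j; rw [if_neg (not_lt.2 hij.le), if_pos (Or.inr rfl)] at this
        exact (Finset.mem_filter.1 this).2
      refine ⟨⟨fun m hm => ?_, Or.inl (hne1 _ hi)⟩, fun m => ?_, hi, hj⟩
      · have := h m; rw [if_pos hm, Finset.mem_singleton] at this; exact this
      · have := h m
        by_cases hm : m < i
        · rw [if_pos hm, Finset.mem_singleton] at this; rw [this, ZMod.val_zero]; exact hR
        · rw [if_neg hm] at this
          split_ifs at this <;> have := (Finset.mem_filter.1 this).2 <;> omega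
  rw [hset, Fintype.card_piFinset]
  have hcard : ∀ m : Fin d, (if m < i then ({0} : Finset (ZMod L))
      else if m = i ∨ m = j then Finset.univ.filter (fun c : ZMod L => c.val + 1 < R)
      else Finset.univ.filter (fun c : ZMod L => c.val < R)).card =
      if m < i then 1 else if m = i ∨ m = j then R - 1 else R := by
    intro m
    split_ifs
    · rfl
    · exact card_filter_val_succ_lt (by omega)
    · exact card_filter_val_lt (by omega)
  simp_rw [hcard]
  -- split off the factor at `j`; the rest is the shape of `prod_ite_lt_eq_ite`
  have hij0 : i ≠ j := ne_of_lt hij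
  rw [← Finset.mul_prod_erase Finset.univ _ (Finset.mem_univ j), if_neg (not_lt.2 hij.le),
    if_pos (Or.inr rfl)]
  have hrest : ∏ m ∈ Finset.univ.erase j, (if m < i then 1 else if m = i ∨ m = j then R - 1 else R) =
      ∏ m ∈ Finset.univ.erase j, (if m < i then 1 else if m = i then R - 1 else R) := by
    refine Finset.prod_congr rfl fun m hm => ?_
    have hmj : m ≠ j := Finset.ne_of_mem_erase hm
    simp only [hmj, or_false]
  rw [hrest]
  have hfull := Finset.mul_prod_erase Finset.univ
    (fun m : Fin d => if m < i then 1 else if m = i then R - 1 else R) (Finset.mem_univ j)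
  rw [prod_ite_lt_eq_ite i (R - 1) R] at hfull
  simp only [if_neg (not_lt.2 hij.le), if_neg (Ne.symm hij0)] at hfull
  -- `R · rest = (R−1)·R^{d−1−i}` with `d − 1 − i = (d − 2 − i) + 1`
  have hdi : d - 1 - (i : ℕ) = d - 2 - (i : ℕ) + 1 := by
    have := j.isLt; have := hij; omega
  rw [hdi, pow_succ] at hfull
  have hrest_eq : ∏ m ∈ Finset.univ.erase j, (if m < i then 1 else if m = i then R - 1 else R) =
      (R - 1) * R ^ (d - 2 - (i : ℕ)) := by
    apply Nat.eq_of_mul_eq_mul_left (show 0 < R from hR)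
    rw [hfull]; ring
  rw [hrest_eq]; ring

omit [NeZero L] in
/-- `Σ_{i<j} h i = Σ_i (d − 1 − i)·h i` over the axis pairs of `Fin d`. [folklore] -/
theorem sum_pairs_fst (h : Fin d → ℕ) :
    ∑ q : {q : Fin d × Fin d // q.1 < q.2}, h q.1.1 = ∑ i : Fin d, (d - 1 - (i : ℕ)) * h i := by
  classical
  have hsub : ∑ q : {q : Fin d × Fin d // q.1 < q.2}, h q.1.1 =
      ∑ q ∈ Finset.univ.filter (fun q : Fin d × Fin d => q.1 < q.2), h q.1 :=
    (Finset.sum_subtype (Finset.univ.filter (fun q : Fin d × Fin d => q.1 < q.2))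
      (fun q => by simp) (fun q : Fin d × Fin d => h q.1)).symm
  rw [hsub, Finset.sum_filter, Fintype.sum_prod_type]
  refine Finset.sum_congr rfl fun i _ => ?_
  dsimp only
  rw [Finset.sum_ite, Finset.sum_const_zero, add_zero, Finset.sum_const, smul_eq_mul]
  congr 1
  have : Finset.univ.filter (fun j : Fin d => i < j) = Finset.Ioi i := by ext j; simp
  rw [this, Fin.card_Ioi]

/-- **`#(Morse ∩ K) = Σ_i (d−1−i)·(R−1)²·R^{d−2−i}`** (`1 ≤ R`, `R + 1 ≤ L`). [ours] -/
theorem card_morse_inter_box (hR : 1 ≤ R) (hRL : R + 1 ≤ L) (K BM : Finset (Plaquette d L))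
    (hK : K = Finset.univ.filter (fun p : Plaquette d L =>
      (∀ m : Fin d, (p.1 m).val < R) ∧ (p.1 p.2.1.1).val + 1 < R ∧ (p.1 p.2.1.2).val + 1 < R))
    (hBM : BM = Finset.univ.filter (fun p : Plaquette d L =>
      (∀ m : Fin d, m < p.2.1.1 → p.1 m = 0) ∧
        (p.1 p.2.1.1 ≠ -1 ∨ ((∀ m : Fin d, p.2.1.1 < m → m < p.2.1.2 → p.1 m = 0) ∧ p.1 p.2.1.2 ≠ -1)))) :
    (BM ∩ K).card = ∑ i : Fin d, (d - 1 - (i : ℕ)) * ((R - 1) ^ 2 * R ^ (d - 2 - (i : ℕ))) := by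
  classical
  subst hK; subst hBM
  rw [← Finset.filter_and, Finset.card_filter, Fintype.sum_prod_type_right]
  have hq : ∀ q : {q : Fin d × Fin d // q.1 < q.2},
      ∑ x : Site d L, (if ((∀ m : Fin d, m < q.1.1 → x m = 0) ∧
          (x q.1.1 ≠ -1 ∨ ((∀ m : Fin d, q.1.1 < m → m < q.1.2 → x m = 0) ∧ x q.1.2 ≠ -1))) ∧
        ((∀ m : Fin d, (x m).val < R) ∧ (x q.1.1).val + 1 < R ∧ (x q.1.2).val + 1 < R) then 1 else 0) =
        (R - 1) ^ 2 * R ^ (d - 2 - (q.1.1 : ℕ)) := by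
    intro q
    obtain ⟨⟨i, j⟩, hij⟩ := q
    simp only
    rw [← Finset.card_filter]
    exact card_morse_inter_box_pair hR hRL hij
  simp_rw [hq]
  exact sum_pairs_fst (fun i : Fin d => (R - 1) ^ 2 * R ^ (d - 2 - (i : ℕ)))

omit [NeZero L] in
/-- The closed form of the Morse box count: `Σ_i (d−1−i)·S²·(S+1)^{d−2−i} + (S+1)^d = d·(S+1)^{d−1}·S + 1`
(`R = S + 1`; `= #links(K) − #sites(K) + 1`). [ours] -/
theorem sum_morse_box_closed (S : ℕ) : ∀ d : ℕ,
    ∑ i : Fin d, (d - 1 - (i : ℕ)) * (S ^ 2 * (S + 1) ^ (d - 2 - (i : ℕ))) + (S + 1) ^ d =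
      d * (S + 1) ^ (d - 1) * S + 1
  | 0 => by simp
  | 1 => by simp
  | (n + 2) => by
    have ih := sum_morse_box_closed S (n + 1)
    rw [Fin.sum_univ_succ]
    have hre : (∑ i : Fin (n + 1), (n + 2 - 1 - ((Fin.succ i : Fin (n + 2)) : ℕ)) *
        (S ^ 2 * (S + 1) ^ (n + 2 - 2 - ((Fin.succ i : Fin (n + 2)) : ℕ)))) =
        ∑ i : Fin (n + 1), (n + 1 - 1 - (i : ℕ)) * (S ^ 2 * (S + 1) ^ (n + 1 - 2 - (i : ℕ))) := by
      refine Finset.sum_congr rfl fun i _ => ?_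
      rw [Fin.val_succ]
      have h1 : n + 2 - 1 - ((i : ℕ) + 1) = n + 1 - 1 - (i : ℕ) := by omega
      have h2 : n + 2 - 2 - ((i : ℕ) + 1) = n + 1 - 2 - (i : ℕ) := by omega
      rw [h1, h2]
    rw [hre]
    set T := ∑ i : Fin (n + 1), (n + 1 - 1 - (i : ℕ)) * (S ^ 2 * (S + 1) ^ (n + 1 - 2 - (i : ℕ))) with hT
    simp only [Fin.val_zero, Nat.sub_zero, Nat.add_sub_cancel, show n + 2 - 1 = n + 1 from rfl] at ih ⊢
    have e1 : (S + 1) ^ (n + 1) = (S + 1) ^ n * (S + 1) := pow_succ _ _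
    have e2 : (S + 1) ^ (n + 2) = (S + 1) ^ n * (S + 1) * (S + 1) := by rw [pow_succ, pow_succ]
    rw [e1] at ih
    rw [e2, e1]
    nlinarith [ih]

/-- **`#(Morse ∩ K) + R^d = d·R^{d−1}·(R−1) + 1`** (`1 ≤ R`, `R + 1 ≤ L`): the Morse structure cut to the
box has exactly `#links(K) − #sites(K) + 1` plaquettes — the box is contractible, nothing is lost to
cycles. [ours] -/
theorem card_morse_inter_box_closed (hR : 1 ≤ R) (hRL : R + 1 ≤ L) (K BM : Finset (Plaquette d L))
    (hK : K = Finset.univ.filter (fun p : Plaquette d L =>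
      (∀ m : Fin d, (p.1 m).val < R) ∧ (p.1 p.2.1.1).val + 1 < R ∧ (p.1 p.2.1.2).val + 1 < R))
    (hBM : BM = Finset.univ.filter (fun p : Plaquette d L =>
      (∀ m : Fin d, m < p.2.1.1 → p.1 m = 0) ∧
        (p.1 p.2.1.1 ≠ -1 ∨ ((∀ m : Fin d, p.2.1.1 < m → m < p.2.1.2 → p.1 m = 0) ∧ p.1 p.2.1.2 ≠ -1)))) :
    (BM ∩ K).card + R ^ d = d * R ^ (d - 1) * (R - 1) + 1 := by
  rw [card_morse_inter_box hR hRL K BM hK hBM]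
  obtain ⟨S, rfl⟩ : ∃ S, R = S + 1 := ⟨R - 1, by omega⟩
  rw [Nat.add_sub_cancel]
  exact sum_morse_box_closed S d

/-! ## §3 The answers: none in two dimensions, one per cube in three, `(R−1)³(3R+1)` in four -/

/-- **THE FREE-BOUNDARY COUNT IN EVERY DIMENSION** (`1 ≤ R`, `R + 1 ≤ L`): the least number `k` of box
plaquettes outside a ranked structure inside the box satisfies
`2k + 2d·R^{d−1}(R−1) + 2 = d(d−1)(R−1)²R^{d−2} + 2R^d`. [ours] -/
theorem isLeast_card_compl_ranked_box_formula (hR : 1 ≤ R) (hRL : R + 1 ≤ L) (K : Finset (Plaquette d L))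
    (hK : K = Finset.univ.filter (fun p : Plaquette d L =>
      (∀ m : Fin d, (p.1 m).val < R) ∧ (p.1 p.2.1.1).val + 1 < R ∧ (p.1 p.2.1.2).val + 1 < R)) :
    ∃ k : ℕ, 2 * k + 2 * (d * R ^ (d - 1) * (R - 1)) + 2 = d * (d - 1) * ((R - 1) ^ 2 * R ^ (d - 2)) + 2 * R ^ d ∧
    IsLeast {k : ℕ | ∃ (B : Finset (Plaquette d L)) (t : Plaquette d L → Edge d L)
      (rank : Plaquette d L → ℕ), B ⊆ K ∧
      (∀ p ∈ B, t p ∈ ({(p.1, p.2.1.1), (p.1.shift p.2.1.1, p.2.1.2),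
        (p.1.shift p.2.1.2, p.2.1.1), (p.1, p.2.1.2)} : Finset (Edge d L))) ∧
      (∀ p ∈ B, ∀ p' ∈ B, p ≠ p' → t p ∈ ({(p'.1, p'.2.1.1), (p'.1.shift p'.2.1.1, p'.2.1.2),
        (p'.1.shift p'.2.1.2, p'.2.1.1), (p'.1, p'.2.1.2)} : Finset (Edge d L)) → rank p < rank p') ∧
      (K \ B).card = k} k := by
  have hL : 2 ≤ L := by omega
  refine ⟨_, ?_, isLeast_card_compl_ranked_box hL hRL K hK _ rfl⟩
  have h1 := two_mul_card_box (d := d) (by omega : R ≤ L) K hK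
  have h2 := card_morse_inter_box_closed (d := d) hR hRL K _ hK rfl
  have h3 : (K \ (Finset.univ.filter (fun p : Plaquette d L =>
      (∀ m : Fin d, m < p.2.1.1 → p.1 m = 0) ∧
        (p.1 p.2.1.1 ≠ -1 ∨ ((∀ m : Fin d, p.2.1.1 < m → m < p.2.1.2 → p.1 m = 0) ∧ p.1 p.2.1.2 ≠ -1))))).card +
      ((Finset.univ.filter (fun p : Plaquette d L =>
      (∀ m : Fin d, m < p.2.1.1 → p.1 m = 0) ∧
        (p.1 p.2.1.1 ≠ -1 ∨ ((∀ m : Fin d, p.2.1.1 < m → m < p.2.1.2 → p.1 m = 0) ∧ p.1 p.2.1.2 ≠ -1)))) ∩ K).card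
      = K.card := by
    rw [Finset.inter_comm, Finset.card_sdiff_add_card_inter]
  omega

/-- **THREE DIMENSIONS, FREE BOUNDARY: EXACTLY ONE PLAQUETTE PER UNIT CUBE.**  In the box of side `R` of
`(ℤ/L)³` (`1 ≤ R`, `R + 1 ≤ L`; `3R(R−1)²` plaquettes, `(R−1)³` unit cubes) the least number of plaquettes
outside a ranked one-plaquette heat-bath structure is `(R−1)³`. [ours] -/
theorem isLeast_card_compl_ranked_box_three (hR : 1 ≤ R) (hRL : R + 1 ≤ L) (K : Finset (Plaquette 3 L))
    (hK : K = Finset.univ.filter (fun p : Plaquette 3 L =>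
      (∀ m : Fin 3, (p.1 m).val < R) ∧ (p.1 p.2.1.1).val + 1 < R ∧ (p.1 p.2.1.2).val + 1 < R)) :
    IsLeast {k : ℕ | ∃ (B : Finset (Plaquette 3 L)) (t : Plaquette 3 L → Edge 3 L)
      (rank : Plaquette 3 L → ℕ), B ⊆ K ∧
      (∀ p ∈ B, t p ∈ ({(p.1, p.2.1.1), (p.1.shift p.2.1.1, p.2.1.2),
        (p.1.shift p.2.1.2, p.2.1.1), (p.1, p.2.1.2)} : Finset (Edge 3 L))) ∧
      (∀ p ∈ B, ∀ p' ∈ B, p ≠ p' → t p ∈ ({(p'.1, p'.2.1.1), (p'.1.shift p'.2.1.1, p'.2.1.2),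
        (p'.1.shift p'.2.1.2, p'.2.1.1), (p'.1, p'.2.1.2)} : Finset (Edge 3 L)) → rank p < rank p') ∧
      (K \ B).card = k} ((R - 1) ^ 3) := by
  obtain ⟨k, hk, h⟩ := isLeast_card_compl_ranked_box_formula (d := 3) hR hRL K hK
  obtain ⟨S, rfl⟩ : ∃ S, R = S + 1 := ⟨R - 1, by omega⟩
  simp only [Nat.add_sub_cancel] at hk ⊢
  norm_num at hk
  have : k = S ^ 3 := by nlinarith [hk]
  rwa [this] at h

/-- **TWO DIMENSIONS, FREE BOUNDARY: NOTHING STAYS OUTSIDE** (`1 ≤ R`, `R + 1 ≤ L`) — the combinatorial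
shadow of `AutoregressiveGaugeHeatBathExact2D`: the whole box is ranked. [ours] -/
theorem isLeast_card_compl_ranked_box_two (hR : 1 ≤ R) (hRL : R + 1 ≤ L) (K : Finset (Plaquette 2 L))
    (hK : K = Finset.univ.filter (fun p : Plaquette 2 L =>
      (∀ m : Fin 2, (p.1 m).val < R) ∧ (p.1 p.2.1.1).val + 1 < R ∧ (p.1 p.2.1.2).val + 1 < R)) :
    IsLeast {k : ℕ | ∃ (B : Finset (Plaquette 2 L)) (t : Plaquette 2 L → Edge 2 L)
      (rank : Plaquette 2 L → ℕ), B ⊆ K ∧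
      (∀ p ∈ B, t p ∈ ({(p.1, p.2.1.1), (p.1.shift p.2.1.1, p.2.1.2),
        (p.1.shift p.2.1.2, p.2.1.1), (p.1, p.2.1.2)} : Finset (Edge 2 L))) ∧
      (∀ p ∈ B, ∀ p' ∈ B, p ≠ p' → t p ∈ ({(p'.1, p'.2.1.1), (p'.1.shift p'.2.1.1, p'.2.1.2),
        (p'.1.shift p'.2.1.2, p'.2.1.1), (p'.1, p'.2.1.2)} : Finset (Edge 2 L)) → rank p < rank p') ∧
      (K \ B).card = k} 0 := by
  obtain ⟨k, hk, h⟩ := isLeast_card_compl_ranked_box_formula (d := 2) hR hRL K hK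
  obtain ⟨S, rfl⟩ : ∃ S, R = S + 1 := ⟨R - 1, by omega⟩
  simp only [Nat.add_sub_cancel] at hk ⊢
  norm_num at hk
  have : k = 0 := by nlinarith [hk]
  rwa [this] at h

/-- **FOUR DIMENSIONS, FREE BOUNDARY: `(R−1)³(3R+1) = #cubes − #hypercubes`** (`1 ≤ R`, `R + 1 ≤ L`; of
`6R²(R−1)²` box plaquettes). [ours] -/
theorem isLeast_card_compl_ranked_box_four (hR : 1 ≤ R) (hRL : R + 1 ≤ L) (K : Finset (Plaquette 4 L))
    (hK : K = Finset.univ.filter (fun p : Plaquette 4 L =>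
      (∀ m : Fin 4, (p.1 m).val < R) ∧ (p.1 p.2.1.1).val + 1 < R ∧ (p.1 p.2.1.2).val + 1 < R)) :
    IsLeast {k : ℕ | ∃ (B : Finset (Plaquette 4 L)) (t : Plaquette 4 L → Edge 4 L)
      (rank : Plaquette 4 L → ℕ), B ⊆ K ∧
      (∀ p ∈ B, t p ∈ ({(p.1, p.2.1.1), (p.1.shift p.2.1.1, p.2.1.2),
        (p.1.shift p.2.1.2, p.2.1.1), (p.1, p.2.1.2)} : Finset (Edge 4 L))) ∧
      (∀ p ∈ B, ∀ p' ∈ B, p ≠ p' → t p ∈ ({(p'.1, p'.2.1.1), (p'.1.shift p'.2.1.1, p'.2.1.2),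
        (p'.1.shift p'.2.1.2, p'.2.1.1), (p'.1, p'.2.1.2)} : Finset (Edge 4 L)) → rank p < rank p') ∧
      (K \ B).card = k} ((R - 1) ^ 3 * (3 * R + 1)) := by
  obtain ⟨k, hk, h⟩ := isLeast_card_compl_ranked_box_formula (d := 4) hR hRL K hK
  obtain ⟨S, rfl⟩ : ∃ S, R = S + 1 := ⟨R - 1, by omega⟩
  simp only [Nat.add_sub_cancel] at hk ⊢
  norm_num at hk
  have : k = S ^ 3 * (3 * (S + 1) + 1) := by nlinarith [hk]
  rwa [this] at h

end Summit.Ventures.LatticeQCDFlow.Theory2.Autoregressive
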